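/-
Copyright (c) 2026 the pub-hodgecm-mathlib formalisation cell (harness21).  Prover seat hodgecm-mathlib-LH4-p08 (g11) (valve hand), Track B «K2-LIT»,
#184♮ = hLiu418 = `stmt-HodgeConjecture-24832`; socket #41, KIND W — (KW-arch-hBL) FILE 2 of K2E3-p11 (g10)'s census 01:03:09Z: the two DEFINITE per-place
GROWTH siblings of the Whittaker letters.  THEOREMS ONLY (no `def`, no `instance`, no notation, no named-fact hypothesis, no `sorry`).
-/
import Summits.HodgeConjecture.HodgeConjecture.Theorems.K2LiuKindWArchWhittakerLetterExplicit   -- FILE 2a: the letter written out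
import HarnessLib

/-!
# Crux `HLiu418`, socket #41, KIND W — `K2LiuKindWArchWhittakerGrowth`: GROWTH OF THE CONTINUED PER-PLACE WHITTAKER LETTERS AT A DEFINITE FRAMED INDEX

Cell `hodgecm-mathlib`, crux item hLiu418 = `stmt-HodgeConjecture-24832` (helper lane `--supports … --as helper`, count-neutral), route of record `HCCMUnconditional`;
squad K2 ∕ K2Liu, road `K2_Liu`, socket #41, KIND W, (iii-arch) block letter `hBL` (★ `K2LiuKindWBlockOfRecordCMOfLocalLettersHaar` :170–185).  K2E3-p11 (g10)'s census
(K2 bus 01:03:09Z) reduces `hBL` to PER-PLACE GROWTH of the continued twisted unipotent integrals `Ew` in the arch Iwasawa letters `(X₀, R, u₀)` of `diag(C, −B)·g`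
(the (ii″) telescope: `‖Ew s‖ ≤ C·‖det R‖^{2−2re s}·e^{−cg·T₂}·(1+T₂)^N·(1+‖det(R h₁ R)‖^{−N′})`, `h₁ = C⁻ᴴ·hidx·C⁻¹`, `T₂ = Σ_{a,b} ‖(R h₁ R)_{ab}‖`, constants
local in `s`).  THIS FILE pays the two DEFINITE sign cases from FILE 2a ★ `K2LiuKindWArchWhittakerLetterExplicit` (the letter written out, with ★ JUNCTION's growth
clause (ii)): `‖e(tr(h₁X₀))‖ = 1` (`tr(h₁X₀) ∈ ℝ`), `‖χ_k(det R⁻¹)‖ = 1`, `‖‖det R‖^{2−2s}‖ = ‖det R‖^{2−2re s}`, and for `h₂ = R h₁ R ≻ 0`: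
`tr h₂ ≤ T₂ ≤ 2·tr h₂`, `‖det h₂‖ = h₀₀h₁₁ − |h₀₁|²` — so JUNCTION's `C·e^{−π tr}(1+tr)^N(1+det^{−N′})` becomes the telescope with `cg = π∕2`; the window
`hk : −2 ≤ k` puts every `s`-ball `dist s z < re z∕2` inside JUNCTION's `{0 < re(s+1+k∕2)}`.
* §1 letters (norms of the three unimodular∕power factors; the `2 × 2` positive definite entry letters);
* §2 **`exists_twistedWhittaker_growth_of_posDef_pic`** — generic picture predicate: `∃ Ew s₀ X₀ R u₀`, Iwasawa identities ∧ holomorphy on `{0<re}` ∧ the integral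
  identity ∧ the (ii″) growth for THESE letters;
* §3 the head at the `evalAt … Q` picture, positive definite index: **`exists_twistedWhittaker_continuation_growth_of_posDef`**; the (0,2) sibling
  **`…_of_negDef`** (block-sign mirror of ★ p863756, SAME telescope in the ORIGINAL letters) is the sibling file `K2LiuKindWArchWhittakerGrowthNegDef`.
What is NOT here (honest): `N′ = 0` (Shimura's boundary continuity — not in ★ JUNCTION); uniformity of the constants over the K-picture family ∕ over `g`
(the assembler's cross-place step, census (b)); the (1,1) organ (R3).
[Shimura1997, §16.4, §18.4] [KudlaRallis1994, §1].
HONEST LABEL.  Count-neutral helper, closes no socket: `HC_CM` is proved only modulo the 7 printed citations (2 remaining named inputs: hLiu418 =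
`stmt-HodgeConjecture-24832`, h413 = `stmt-HodgeConjecture-24833`) until rung 0 closes.
-/

set_option autoImplicit false
set_option linter.dupNamespace false -- the mandated namespace repeats `HodgeConjecture.HodgeConjecture`

noncomputable section

open Complex Matrix MeasureTheory
open scoped ComplexConjugate ComplexOrder
open Literature.NumberTheory.ModularForms.SiegelUpperHalfSpace (moeb)

namespace Summit.HodgeConjecture.HodgeConjecture.Cruxes.HLiu418.K2LiuKindWArchWhittakerGrowth

open Summit.HodgeConjecture.HodgeConjecture.Cruxes.HLiu418.K2LiuHermTwoGammaDefs (hermTwo hermTwo_eq_of_isHermitian posDef_hermTwo_iff det_hermTwo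
  hermTwo_apply_zero_zero hermTwo_apply_zero_one hermTwo_apply_one_zero hermTwo_apply_one_one)
open Summit.HodgeConjecture.HodgeConjecture.Cruxes.HLiu418.K2LiuHermTwoEtaConvergence (snd_pos_of_cone)
open Summit.HodgeConjecture.HodgeConjecture.Cruxes.HLiu418.K2LiuHermitianTubeCocycle (transl_mul_transl)
open Summit.HodgeConjecture.HodgeConjecture.Cruxes.HLiu418.K2LiuSiegelStabBlocks (mem_unitaryGroup_of_stab moeb_I_eq_I_of_mem_unitaryGroup)
open Summit.HodgeConjecture.HodgeConjecture.Cruxes.HLiu418.K2LiuArchInducedTubeDefs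
open Summit.HodgeConjecture.HodgeConjecture.Cruxes.HLiu418.K2LiuU22CompactPictureDefs
open Summit.HodgeConjecture.HodgeConjecture.Cruxes.HLiu418.K2LiuKindWArchWhittakerLetterNegDef
open Summit.HodgeConjecture.HodgeConjecture.Cruxes.HLiu418.K2LiuKindWArchWhittakerLetterExplicit (exists_twistedWhittaker_explicit_of_posDef_pic)

/-! ## §1 Letters -/

/-- `‖e(tr(h·X))‖ = 1` for hermitian `h, X` (`tr(hX) ∈ ℝ`). [folklore] -/
theorem norm_cexp_trace_mul_of_isHermitian {h X : Matrix (Fin 2) (Fin 2) ℂ} (hh : hᴴ = h) (hX : Xᴴ = X) :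
    ‖cexp ((2 * Real.pi * I) * (h * X).trace)‖ = 1 := by
  have him : ((h * X).trace).im = 0 := by
    rw [← Complex.conj_eq_iff_im]
    have h1 : star (h * X).trace = (h * X).trace := by
      rw [← Matrix.trace_conjTranspose, Matrix.conjTranspose_mul, hh, hX, Matrix.trace_mul_comm]
    exact h1
  rw [Complex.norm_exp]
  have hre : ((2 * Real.pi * I) * (h * X).trace).re = 0 := by
    simp [Complex.mul_re, him]
  rw [hre, Real.exp_zero]

/-- `‖χ_k(z)‖ = 1` for `z ≠ 0`, `χ_k(z) = (z̄ ∕ ‖z‖)^k`. [folklore] -/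
theorem norm_archChar_eq_one {z : ℂ} (hz : z ≠ 0) (k : ℤ) : ‖(conj z / ((‖z‖ : ℝ) : ℂ)) ^ k‖ = 1 := by
  rw [norm_zpow, norm_div, Complex.norm_conj, Complex.norm_real, Real.norm_eq_abs, abs_norm, div_self (norm_ne_zero_iff.2 hz), _root_.one_zpow]

/-- The `2 × 2` positive definite ENTRY LETTERS: `tr h ≤ Σ‖h_{ab}‖ ≤ 2·tr h` and `‖det h‖ = h₀₀h₁₁ − |h₀₁|²`, `0 < tr h`. [folklore] -/
theorem entryLetters_of_posDef {h : Matrix (Fin 2) (Fin 2) ℂ} (hh : h.PosDef) :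
    0 < (h 0 0).re + (h 1 1).re ∧ (h 0 0).re + (h 1 1).re ≤ ∑ a, ∑ b, ‖h a b‖ ∧ ∑ a, ∑ b, ‖h a b‖ ≤ 2 * ((h 0 0).re + (h 1 1).re) ∧
      ‖h.det‖ = (h 0 0).re * (h 1 1).re - normSq (h 0 1) := by
  have hc : hermTwo ((h 0 0).re, h 0 1, (h 1 1).re) = h := hermTwo_eq_of_isHermitian hh.1
  have hd := (posDef_hermTwo_iff ((h 0 0).re, h 0 1, (h 1 1).re)).mp (hc.symm ▸ hh)
  have ha : 0 < (h 0 0).re := hd.1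
  have hb : 0 < (h 1 1).re := snd_pos_of_cone hd.1 hd.2
  have hsq : normSq (h 0 1) < (h 0 0).re * (h 1 1).re := hd.2
  -- the entry sum in the chart
  have hsum : ∑ a, ∑ b, ‖h a b‖ = (h 0 0).re + (h 1 1).re + 2 * ‖h 0 1‖ := by
    conv_lhs => rw [← hc]
    simp only [Fin.sum_univ_two, hermTwo_apply_zero_zero, hermTwo_apply_zero_one, hermTwo_apply_one_zero, hermTwo_apply_one_one,
      Complex.norm_real, Complex.norm_conj, Real.norm_eq_abs, abs_of_pos ha, abs_of_pos hb]
    ring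
  have h01 : 0 ≤ ‖h 0 1‖ := norm_nonneg _
  have h01sq : ‖h 0 1‖ ^ 2 ≤ (h 0 0).re * (h 1 1).re := by
    rw [← Complex.normSq_eq_norm_sq]; exact hsq.le
  have h2 : 2 * ‖h 0 1‖ ≤ (h 0 0).re + (h 1 1).re := by
    nlinarith [sq_nonneg ((h 0 0).re - (h 1 1).re), h01sq, h01, ha.le, hb.le, sq_nonneg (2 * ‖h 0 1‖ - ((h 0 0).re + (h 1 1).re))]
  refine ⟨by linarith, by rw [hsum]; linarith, by rw [hsum]; linarith, ?_⟩
  -- the determinant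
  conv_lhs => rw [← hc, det_hermTwo]
  rw [Complex.norm_real, Real.norm_eq_abs, abs_of_pos (by simpa using hsq)]

/-- **UNIQUENESS OF THE HERMITIAN-LEVI IWASAWA LETTERS.**  Two decompositions `n(X₀)·diag(R, R⁻¹)·u₀ = n(X₁)·diag(R₁, R₁⁻¹)·u₁` with `R, R₁` hermitian
invertible and `u₀, u₁ ∈ Stab(iI)` differ by a unitary `κ`: `R = R₁·κ`, `κᴴκ = κκᴴ = 1` (the quotient `diag(R₁,R₁⁻¹)⁻¹·n(X₁)⁻¹·n(X₀)·diag(R,R⁻¹) = u₁u₀ᴴ` is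
block upper triangular AND unitary — ★ `K2LiuSiegelStabBlocks.mem_unitaryGroup_of_stab`). [Shimura1997, §6.5] -/
theorem levi_letters_unique {X₀ X₁ R R₁ : Matrix (Fin 2) (Fin 2) ℂ} {u₀ u₁ : Matrix (Fin 2 ⊕ Fin 2) (Fin 2 ⊕ Fin 2) ℂ}
    (hR₁u : IsUnit R₁.det)
    (hu₀ : u₀ᴴ * Matrix.J (Fin 2) ℂ * u₀ = Matrix.J (Fin 2) ℂ) (hu₀i : moeb u₀ (I • (1 : Matrix (Fin 2) (Fin 2) ℂ)) = I • 1)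
    (hu₁ : u₁ᴴ * Matrix.J (Fin 2) ℂ * u₁ = Matrix.J (Fin 2) ℂ) (hu₁i : moeb u₁ (I • (1 : Matrix (Fin 2) (Fin 2) ℂ)) = I • 1)
    (h : (fromBlocks 1 X₀ 0 1 : Matrix (Fin 2 ⊕ Fin 2) (Fin 2 ⊕ Fin 2) ℂ) * fromBlocks R 0 0 R⁻¹ * u₀ = fromBlocks 1 X₁ 0 1 * fromBlocks R₁ 0 0 R₁⁻¹ * u₁) :
    ∃ κ : Matrix (Fin 2) (Fin 2) ℂ, κᴴ * κ = 1 ∧ κ * κᴴ = 1 ∧ R = R₁ * κ := by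
  have hU := mem_unitaryGroup_of_stab hu₀ hu₀i
  have hU₁ := mem_unitaryGroup_of_stab hu₁ hu₁i
  have h1 : u₀ * u₀ᴴ = 1 := by
    have h := Matrix.mem_unitaryGroup_iff.1 hU
    rwa [star_eq_conjTranspose] at h
  have h1' : u₁ᴴ * u₁ = 1 := by
    have h := Matrix.mem_unitaryGroup_iff'.1 hU₁
    rwa [star_eq_conjTranspose] at h
  have hR₁R₁i : R₁ * R₁⁻¹ = 1 := Matrix.mul_nonsing_inv R₁ hR₁u
  have hR₁iR₁ : R₁⁻¹ * R₁ = 1 := Matrix.nonsing_inv_mul R₁ hR₁u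
  -- the quotient `w` with `w · u₀ = u₁`
  set w : Matrix (Fin 2 ⊕ Fin 2) (Fin 2 ⊕ Fin 2) ℂ :=
    fromBlocks R₁⁻¹ 0 0 R₁ * (fromBlocks 1 (-X₁ + X₀) 0 1 * fromBlocks R 0 0 R⁻¹) with hw
  have hwb : w = fromBlocks (R₁⁻¹ * R) (R₁⁻¹ * ((-X₁ + X₀) * R⁻¹)) 0 (R₁ * R⁻¹) := by
    rw [hw, fromBlocks_multiply, fromBlocks_multiply]
    simp only [Matrix.mul_zero, Matrix.zero_mul, add_zero, zero_add, Matrix.one_mul]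
  have hwu : w * u₀ = u₁ := by
    calc w * u₀ = fromBlocks R₁⁻¹ 0 0 R₁ * fromBlocks 1 (-X₁) 0 1 * ((fromBlocks 1 X₀ 0 1 : Matrix (Fin 2 ⊕ Fin 2) (Fin 2 ⊕ Fin 2) ℂ) *
          fromBlocks R 0 0 R⁻¹ * u₀) := by
          rw [hw, ← transl_mul_transl]; simp only [Matrix.mul_assoc]
      _ = fromBlocks R₁⁻¹ 0 0 R₁ * ((fromBlocks 1 (-X₁) 0 1 : Matrix (Fin 2 ⊕ Fin 2) (Fin 2 ⊕ Fin 2) ℂ) * fromBlocks 1 X₁ 0 1) *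
          fromBlocks R₁ 0 0 R₁⁻¹ * u₁ := by
          rw [h]; simp only [Matrix.mul_assoc]
      _ = u₁ := by
          rw [transl_mul_transl, neg_add_cancel, fromBlocks_one, Matrix.mul_one, fromBlocks_multiply]
          simp only [Matrix.mul_zero, Matrix.zero_mul, add_zero, zero_add, hR₁R₁i, hR₁iR₁, fromBlocks_one, Matrix.one_mul]
  -- `w = u₁ u₀ᴴ` is unitary
  have hww : wᴴ * w = 1 := by
    have hw' : w = u₁ * u₀ᴴ := by rw [← hwu, Matrix.mul_assoc, h1, Matrix.mul_one]
    rw [hw', conjTranspose_mul, conjTranspose_conjTranspose]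
    calc u₀ * u₁ᴴ * (u₁ * u₀ᴴ) = u₀ * (u₁ᴴ * u₁) * u₀ᴴ := by simp only [Matrix.mul_assoc]
      _ = 1 := by rw [h1', Matrix.mul_one, h1]
  -- its (1,1) block: `κ := R₁⁻¹ R` is unitary
  rw [hwb, fromBlocks_conjTranspose, fromBlocks_multiply, ← fromBlocks_one, fromBlocks_inj] at hww
  obtain ⟨h11, -, -, -⟩ := hww
  simp only [conjTranspose_zero, Matrix.mul_zero, add_zero] at h11
  refine ⟨R₁⁻¹ * R, h11, mul_eq_one_comm.1 h11, ?_⟩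
  rw [← Matrix.mul_assoc, hR₁R₁i, Matrix.one_mul]

/-! ## §2 The growth letter, generic in the picture predicate -/

/-- **GROWTH OF THE CONTINUED TWISTED UNIPOTENT INTEGRAL (positive definite index, generic picture predicate) — the (ii″) telescope.**  Frame data as
in ★ p863627; weight `k ≥ −2`.  ONE function `Ew`, holomorphic on `{0 < re}`, equal to the twisted integral of every flat section with picture `Pic` at
`s₀ < re s`, with the GROWTH FACE: for every `z` with `0 < re z` there are `C ≥ 0`, `cg > 0` (`= π∕2`), `N, N′ ≥ 0`, `r > 0` (`= re z∕2`) such that on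
`dist s z < r`, for EVERY hermitian-Levi arch Iwasawa decomposition `diag(C, −B)·g = n(X₀)·diag(R, R⁻¹)·u₀` (`X₀` hermitian, `R` hermitian invertible,
`u₀ ∈ Stab(iI)`; one exists by ★ `exists_transl_levi_mul_stabilizer`, all differ by a unitary — `levi_letters_unique`),
`‖Ew s‖ ≤ C·‖det R‖^{2−2re s}·e^{−cg·T₂}·(1+T₂)^N·(1+‖det(R h₁ R)‖^{−N′})`, `h₁ = C⁻ᴴ·hidx·C⁻¹`, `T₂ = Σ_{a,b}‖(R h₁ R)_{ab}‖` (entrywise).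
(★ JUNCTION (ii) through FILE 2a; `tr ≤ T₂ ≤ 2 tr` on `h₂ ≻ 0`.) [cite: Shimura1997, §16.4, §18.4] [cite: KudlaRallis1994, §1] -/
theorem exists_twistedWhittaker_growth_of_posDef_pic {k : ℤ} (hk : -2 ≤ k)
    (Pic : ℂ → (Matrix (Fin 2 ⊕ Fin 2) (Fin 2 ⊕ Fin 2) ℂ → ℂ) → Prop)
    {B C : Matrix (Fin 2) (Fin 2) ℂ}
    (hx : (fromBlocks 0 B C 0 : Matrix (Fin 2 ⊕ Fin 2) (Fin 2 ⊕ Fin 2) ℂ)ᴴ * Matrix.J (Fin 2) ℂ * (fromBlocks 0 B C 0 : Matrix (Fin 2 ⊕ Fin 2) (Fin 2 ⊕ Fin 2) ℂ) =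
      Matrix.J (Fin 2) ℂ)
    {g : Matrix (Fin 2 ⊕ Fin 2) (Fin 2 ⊕ Fin 2) ℂ} (hg : gᴴ * Matrix.J (Fin 2) ℂ * g = Matrix.J (Fin 2) ℂ)
    {hidx : Matrix (Fin 2) (Fin 2) ℂ} (hpos : hidx.PosDef)
    {eb : Matrix (Fin 2) (Fin 2) ℂ → ℂ} (heb : ∀ b, eb b = cexp (-(2 * Real.pi * I) * (hidx * b).trace))
    (hKpic : ∀ k₀ : Matrix (Fin 2 ⊕ Fin 2) (Fin 2 ⊕ Fin 2) ℂ, k₀ᴴ * Matrix.J (Fin 2) ℂ * k₀ = Matrix.J (Fin 2) ℂ →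
      moeb k₀ (I • (1 : Matrix (Fin 2) (Fin 2) ℂ)) = I • 1 →
      ∃ P : MvPolynomial (((Fin 2 ⊕ Fin 2) × (Fin 2 ⊕ Fin 2)) ⊕ ((Fin 2 ⊕ Fin 2) × (Fin 2 ⊕ Fin 2))) ℂ,
        ∀ (s : ℂ) (F : Matrix (Fin 2 ⊕ Fin 2) (Fin 2 ⊕ Fin 2) ℂ → ℂ), IsArchSiegelSection (fun z : ℂ => (conj z / ((‖z‖ : ℝ) : ℂ)) ^ k) s F →
          Pic s F →
          ∀ u : Matrix (Fin 2 ⊕ Fin 2) (Fin 2 ⊕ Fin 2) ℂ, uᴴ * Matrix.J (Fin 2) ℂ * u = Matrix.J (Fin 2) ℂ → moeb u (I • (1 : Matrix (Fin 2) (Fin 2) ℂ)) = I • 1 →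
            F (u * k₀) = MvPolynomial.eval (Sum.elim (fun pq => u pq.1 pq.2) (fun pq => conj (u pq.1 pq.2))) P) :
    ∃ (Ew : ℂ → ℂ) (s₀ : ℝ), DifferentiableOn ℂ Ew {s : ℂ | 0 < s.re} ∧
      (∀ s : ℂ, s₀ < s.re →
        ∀ F : Matrix (Fin 2 ⊕ Fin 2) (Fin 2 ⊕ Fin 2) ℂ → ℂ, IsArchSiegelSection (fun z : ℂ => (conj z / ((‖z‖ : ℝ) : ℂ)) ^ k) s F → Pic s F →
          ∫ r : Fin 2 → Fin 2 → ℝ, F ((fromBlocks 0 B C 0 : Matrix (Fin 2 ⊕ Fin 2) (Fin 2 ⊕ Fin 2) ℂ) * fromBlocks 1 (hermOfReal r) 0 1 * g) * eb (hermOfReal r) =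
            Ew s) ∧
      ∀ z : ℂ, 0 < z.re → ∃ Cg cg N N' r : ℝ, 0 ≤ Cg ∧ 0 < cg ∧ 0 ≤ N ∧ 0 ≤ N' ∧ 0 < r ∧ ∀ s : ℂ, dist s z < r →
        ∀ (X₀ R : Matrix (Fin 2) (Fin 2) ℂ) (u₀ : Matrix (Fin 2 ⊕ Fin 2) (Fin 2 ⊕ Fin 2) ℂ), X₀ᴴ = X₀ → Rᴴ = R → IsUnit R.det →
          u₀ᴴ * Matrix.J (Fin 2) ℂ * u₀ = Matrix.J (Fin 2) ℂ → moeb u₀ (I • (1 : Matrix (Fin 2) (Fin 2) ℂ)) = I • 1 →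
          (fromBlocks C 0 0 (-B) : Matrix (Fin 2 ⊕ Fin 2) (Fin 2 ⊕ Fin 2) ℂ) * g = fromBlocks 1 X₀ 0 1 * fromBlocks R 0 0 R⁻¹ * u₀ →
          ‖Ew s‖ ≤ Cg * ‖R.det‖ ^ (2 - 2 * s.re) * Real.exp (-(cg * ∑ a, ∑ b, ‖(R * ((C⁻¹)ᴴ * hidx * C⁻¹) * R) a b‖)) *
            (1 + ∑ a, ∑ b, ‖(R * ((C⁻¹)ᴴ * hidx * C⁻¹) * R) a b‖) ^ N * (1 + ‖(R * ((C⁻¹)ᴴ * hidx * C⁻¹) * R).det‖ ^ (-N')) := by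
  obtain ⟨Xm, Rm, um, P, FJ, s₀, hXm, hRm, hRmu, humJ, humi, hgm, -, hFJhol, hFJgr, hEw⟩ :=
    exists_twistedWhittaker_explicit_of_posDef_pic k Pic hx hg hpos heb hKpic
  /- the frame letters -/
  obtain ⟨-, hBC⟩ := K2LiuArchBlockOfFrame.antidiag_letters hx
  have hC : C.det ≠ 0 := (Matrix.isUnit_det_of_left_inverse hBC).ne_zero
  have hCu : IsUnit C.det := isUnit_iff_ne_zero.2 hC
  have hCCi : C * C⁻¹ = 1 := Matrix.mul_nonsing_inv C hCu
  have hCiu : IsUnit C⁻¹ := by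
    rw [Matrix.isUnit_iff_isUnit_det]; exact Matrix.isUnit_det_of_left_inverse hCCi
  have hRmu' : IsUnit Rm := (Matrix.isUnit_iff_isUnit_det Rm).2 hRmu
  have hRmdet : Rm.det ≠ 0 := hRmu.ne_zero
  have hRmpos : 0 < ‖Rm.det‖ := norm_pos_iff.2 hRmdet
  set h₁ : Matrix (Fin 2) (Fin 2) ℂ := (C⁻¹)ᴴ * hidx * C⁻¹ with hh₁
  set h₂ : Matrix (Fin 2) (Fin 2) ℂ := Rm * h₁ * Rm with hh₂
  have h₁pos : h₁.PosDef := hpos.conjTranspose_mul_mul_same (Matrix.mulVec_injective_iff_isUnit.2 hCiu)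
  have h₂pos : h₂.PosDef := by
    have h := h₁pos.conjTranspose_mul_mul_same (Matrix.mulVec_injective_iff_isUnit.2 hRmu')
    rwa [hRm] at h
  have hRR : Rmᴴ * h₁ * Rm = h₂ := by rw [hh₂, hRm]
  -- the holomorphy window `{0 < re} ⊆ {0 < re(s + 1 + k∕2)}`
  have hwin : ∀ s : ℂ, 0 < s.re → 0 < (s + 1 + (k : ℂ) / 2).re := by
    intro s hs
    have hk' : (-2 : ℝ) ≤ (k : ℝ) := by exact_mod_cast hk
    have hre : (s + 1 + (k : ℂ) / 2).re = s.re + 1 + (k : ℝ) / 2 := by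
      simp [Complex.add_re, Complex.div_ofNat_re]
    rw [hre]
    linarith
  have hopen : IsOpen {s : ℂ | 0 < s.re} := isOpen_lt continuous_const Complex.continuous_re
  /- the three unimodular ∕ power factors -/
  set χ : ℂ → ℂ := fun z : ℂ => (conj z / ((‖z‖ : ℝ) : ℂ)) ^ k with hχ
  set K₀ : ℂ := cexp ((2 * Real.pi * I) * (h₁ * Xm).trace) with hK₀
  have hK₀n : ‖K₀‖ = 1 := norm_cexp_trace_mul_of_isHermitian h₁pos.1 hXm
  have hχn : ‖χ Rm⁻¹.det‖ = 1 := by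
    have hne : Rm⁻¹.det ≠ 0 := by
      rw [Matrix.det_nonsing_inv, Ring.inverse_eq_inv']
      exact inv_ne_zero hRmdet
    exact norm_archChar_eq_one hne k
  have hpow : ∀ s : ℂ, ‖(((‖Rm.det‖ : ℝ) : ℂ) ^ (2 - 2 * s))‖ = ‖Rm.det‖ ^ (2 - 2 * s.re) := by
    intro s
    rw [Complex.norm_cpow_eq_rpow_re_of_pos hRmpos]
    congr 1
    simp [Complex.sub_re, Complex.mul_re]
  refine ⟨fun s => (1 / 8 : ℂ) * (((((‖C.det‖ : ℝ) : ℂ) ^ 4)⁻¹) * (cexp ((2 * Real.pi * I) * (((C⁻¹)ᴴ * hidx * C⁻¹) * Xm).trace) *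
      ((fun z : ℂ => (conj z / ((‖z‖ : ℝ) : ℂ)) ^ k) Rm⁻¹.det * (((‖Rm.det‖ : ℝ) : ℂ) ^ (2 - 2 * s) * FJ (Rmᴴ * ((C⁻¹)ᴴ * hidx * C⁻¹) * Rm) s)))),
    s₀, ?_, fun s hs F hF hFQ => hEw s hs F hF hFQ, fun z hz => ?_⟩
  · -- holomorphy on `{0 < re}`
    have hcpow : Differentiable ℂ (fun s : ℂ => ((‖Rm.det‖ : ℝ) : ℂ) ^ (2 - 2 * s)) :=
      Differentiable.const_cpow ((differentiable_const _).sub ((differentiable_const _).mul differentiable_id))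
        (Or.inl (ofReal_ne_zero.2 hRmpos.ne'))
    have hF2 : DifferentiableOn ℂ (FJ (Rmᴴ * ((C⁻¹)ᴴ * hidx * C⁻¹) * Rm)) {s : ℂ | 0 < s.re} := by
      rw [← hh₁, hRR]; exact hFJhol hopen (fun s hs => hwin s hs) h₂pos
    exact (differentiableOn_const _).mul ((differentiableOn_const _).mul ((differentiableOn_const _).mul
      ((differentiableOn_const _).mul (hcpow.differentiableOn.mul hF2))))
  · /- growth on the ball `dist s z < re z ∕ 2`, for every hermitian-Levi decomposition -/
    set r : ℝ := z.re / 2 with hr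
    have hr0 : 0 < r := by rw [hr]; linarith
    have hKc : IsCompact (Metric.closedBall z r) := isCompact_closedBall z r
    have hKre : ∀ s ∈ Metric.closedBall z r, 0 < s.re := by
      intro s hs
      have h1 : |(s - z).re| ≤ ‖s - z‖ := Complex.abs_re_le_norm (s - z)
      rw [Metric.mem_closedBall, dist_eq_norm] at hs
      rw [Complex.sub_re] at h1
      have h2 := (abs_le.1 (h1.trans hs)).1
      rw [hr] at h2
      linarith
    obtain ⟨Cg, N, N', hCg, hN, hN', hB⟩ := hFJgr hKc (fun s hs => hwin s (hKre s hs))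
    refine ⟨8⁻¹ * (‖C.det‖ ^ 4)⁻¹ * Cg, Real.pi / 2, N, N', r, by positivity, by positivity, hN, hN', hr0,
      fun s hs X₀ R u₀ _hX₀ hR hRu hu₀J hu₀i hdec => ?_⟩
    have hsK : s ∈ Metric.closedBall z r := Metric.mem_closedBall.2 hs.le
    have hFJ := hB h₂ h₂pos s hsK
    /- the given decomposition differs from ours by a unitary `κ`: `Rm = R κ = κᴴ R` -/
    obtain ⟨κ, hκ1, hκ2, hRκ⟩ := levi_letters_unique hRu humJ humi hu₀J hu₀i (hgm.symm.trans hdec)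
    have hRκ' : Rm = κᴴ * R := by rw [← hRm, hRκ, conjTranspose_mul, hR]
    have hRu' : IsUnit R := (Matrix.isUnit_iff_isUnit_det R).2 hRu
    set h₂' : Matrix (Fin 2) (Fin 2) ℂ := R * h₁ * R with hh₂'
    have h₂'pos : h₂'.PosDef := by
      have h := h₁pos.conjTranspose_mul_mul_same (Matrix.mulVec_injective_iff_isUnit.2 hRu')
      rwa [hR] at h
    have hconj : h₂ = κᴴ * h₂' * κ := by
      rw [hh₂, hh₂']
      calc Rm * h₁ * Rm = κᴴ * R * h₁ * (R * κ) := by rw [← hRκ', ← hRκ]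
        _ = κᴴ * (R * h₁ * R) * κ := by simp only [Matrix.mul_assoc]
    have hdκ : κᴴ.det * κ.det = 1 := by rw [← Matrix.det_mul, hκ1, Matrix.det_one]
    have hnκ : ‖κ.det‖ = 1 := by
      have h := congrArg norm hdκ
      rw [norm_mul, Matrix.det_conjTranspose, norm_star, norm_one] at h
      nlinarith [norm_nonneg κ.det]
    -- the invariants: `‖det Rm‖ = ‖det R‖`, `tr h₂ = tr h₂'`, `‖det h₂‖ = ‖det h₂'‖`
    have hdetR : ‖Rm.det‖ = ‖R.det‖ := by rw [hRκ, Matrix.det_mul, norm_mul, hnκ, mul_one]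
    have htr : (h₂ 0 0).re + (h₂ 1 1).re = (h₂' 0 0).re + (h₂' 1 1).re := by
      have h : h₂.trace = h₂'.trace := by
        rw [hconj, Matrix.trace_mul_cycle, hκ2, Matrix.one_mul]
      rw [Matrix.trace_fin_two, Matrix.trace_fin_two] at h
      have h' := congrArg Complex.re h
      simpa only [Complex.add_re] using h'
    have hdet2 : h₂.det = h₂'.det := by
      rw [hconj, Matrix.det_mul, Matrix.det_mul]
      calc κᴴ.det * h₂'.det * κ.det = h₂'.det * (κᴴ.det * κ.det) := by ring
        _ = h₂'.det := by rw [hdκ, mul_one]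
    obtain ⟨htr0, -, -, hdet⟩ := entryLetters_of_posDef h₂pos
    obtain ⟨htr0', htrle', hT2le', hdet'⟩ := entryLetters_of_posDef h₂'pos
    -- the norm of the explicit continuation
    have hn : ‖(1 / 8 : ℂ) * (((((‖C.det‖ : ℝ) : ℂ) ^ 4)⁻¹) * (cexp ((2 * Real.pi * I) * (((C⁻¹)ᴴ * hidx * C⁻¹) * Xm).trace) *
        ((fun z : ℂ => (conj z / ((‖z‖ : ℝ) : ℂ)) ^ k) Rm⁻¹.det * (((‖Rm.det‖ : ℝ) : ℂ) ^ (2 - 2 * s) * FJ (Rmᴴ * ((C⁻¹)ᴴ * hidx * C⁻¹) * Rm) s))))‖ =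
        8⁻¹ * (‖C.det‖ ^ 4)⁻¹ * (‖Rm.det‖ ^ (2 - 2 * s.re) * ‖FJ h₂ s‖) := by
      rw [← hh₁, ← hK₀, ← hχ, hRR, norm_mul, norm_mul, norm_mul, norm_mul, norm_mul, hK₀n, hχn, one_mul, one_mul, hpow s, norm_inv, norm_pow,
        Complex.norm_real, Real.norm_eq_abs, abs_norm]
      have h8 : ‖(1 / 8 : ℂ)‖ = 8⁻¹ := by norm_num
      rw [h8]
      ring
    show ‖(1 / 8 : ℂ) * (((((‖C.det‖ : ℝ) : ℂ) ^ 4)⁻¹) * (cexp ((2 * Real.pi * I) * (((C⁻¹)ᴴ * hidx * C⁻¹) * Xm).trace) *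
        ((fun z : ℂ => (conj z / ((‖z‖ : ℝ) : ℂ)) ^ k) Rm⁻¹.det * (((‖Rm.det‖ : ℝ) : ℂ) ^ (2 - 2 * s) * FJ (Rmᴴ * ((C⁻¹)ᴴ * hidx * C⁻¹) * Rm) s))))‖ ≤ _
    rw [hn, hdetR, ← hdet2, hdet]
    have hexp : Real.exp (-(Real.pi * ((h₂ 0 0).re + (h₂ 1 1).re))) ≤ Real.exp (-(Real.pi / 2 * ∑ a, ∑ b, ‖h₂' a b‖)) := by
      rw [Real.exp_le_exp, htr]
      nlinarith [hT2le', Real.pi_pos]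
    have hpol : (1 + ((h₂ 0 0).re + (h₂ 1 1).re)) ^ N ≤ (1 + ∑ a, ∑ b, ‖h₂' a b‖) ^ N :=
      Real.rpow_le_rpow (by linarith [htr, htr0']) (by linarith [htr, htrle']) hN
    have hdet0 : 0 ≤ 1 + ((h₂ 0 0).re * (h₂ 1 1).re - normSq (h₂ 0 1)) ^ (-N') := by
      have := K2LiuHermTwoConfluentXiRegularity.det_re_pos_of_posDef h₂pos
      positivity
    have hRp : 0 ≤ ‖R.det‖ ^ (2 - 2 * s.re) := Real.rpow_nonneg (norm_nonneg _) _
    calc 8⁻¹ * (‖C.det‖ ^ 4)⁻¹ * (‖R.det‖ ^ (2 - 2 * s.re) * ‖FJ h₂ s‖)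
        ≤ 8⁻¹ * (‖C.det‖ ^ 4)⁻¹ * (‖R.det‖ ^ (2 - 2 * s.re) * (Cg * Real.exp (-(Real.pi * ((h₂ 0 0).re + (h₂ 1 1).re))) *
            (1 + ((h₂ 0 0).re + (h₂ 1 1).re)) ^ N * (1 + ((h₂ 0 0).re * (h₂ 1 1).re - normSq (h₂ 0 1)) ^ (-N')))) := by
          gcongr
      _ ≤ 8⁻¹ * (‖C.det‖ ^ 4)⁻¹ * (‖R.det‖ ^ (2 - 2 * s.re) * (Cg * Real.exp (-(Real.pi / 2 * ∑ a, ∑ b, ‖h₂' a b‖)) *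
            (1 + ∑ a, ∑ b, ‖h₂' a b‖) ^ N * (1 + ((h₂ 0 0).re * (h₂ 1 1).re - normSq (h₂ 0 1)) ^ (-N')))) := by
          gcongr
      _ = 8⁻¹ * (‖C.det‖ ^ 4)⁻¹ * Cg * ‖R.det‖ ^ (2 - 2 * s.re) * Real.exp (-(Real.pi / 2 * ∑ a, ∑ b, ‖h₂' a b‖)) *
            (1 + ∑ a, ∑ b, ‖h₂' a b‖) ^ N * (1 + ((h₂ 0 0).re * (h₂ 1 1).re - normSq (h₂ 0 1)) ^ (-N')) := by ring

/-! ## §3 The head at the compact picture `evalAt … Q`, positive definite framed index -/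

/-- **THE PER-PLACE WHITTAKER LETTER WITH GROWTH — POSITIVE DEFINITE FRAMED INDEX (signature (2,0)).**  ★ p863390's binders VERBATIM; conclusion = ★
p863390's (holomorphy ∧ the formula for every flat section with picture `Q`) ∧ the (ii″) GROWTH FACE over every hermitian-Levi Iwasawa decomposition of
`diag(C, −B)·g` (entrywise `T₂`, `cg = π∕2`, `N′ ≥ 0` by value of ★ JUNCTION). [cite: Shimura1997, §16.4, §18.4] [cite: KudlaRallis1994, §1] -/
theorem exists_twistedWhittaker_continuation_growth_of_posDef {k : ℤ} (hk : -2 ≤ k) (Q : Carrier)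
    {B C : Matrix (Fin 2) (Fin 2) ℂ}
    (hx : (fromBlocks 0 B C 0 : Matrix (Fin 2 ⊕ Fin 2) (Fin 2 ⊕ Fin 2) ℂ)ᴴ * Matrix.J (Fin 2) ℂ * (fromBlocks 0 B C 0 : Matrix (Fin 2 ⊕ Fin 2) (Fin 2 ⊕ Fin 2) ℂ) =
      Matrix.J (Fin 2) ℂ)
    {g : Matrix (Fin 2 ⊕ Fin 2) (Fin 2 ⊕ Fin 2) ℂ} (hg : gᴴ * Matrix.J (Fin 2) ℂ * g = Matrix.J (Fin 2) ℂ)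
    {hidx : Matrix (Fin 2) (Fin 2) ℂ} (hpos : hidx.PosDef)
    {eb : Matrix (Fin 2) (Fin 2) ℂ → ℂ} (heb : ∀ b, eb b = cexp (-(2 * Real.pi * I) * (hidx * b).trace))
    (hKpic : ∀ k₀ : Matrix (Fin 2 ⊕ Fin 2) (Fin 2 ⊕ Fin 2) ℂ, k₀ᴴ * Matrix.J (Fin 2) ℂ * k₀ = Matrix.J (Fin 2) ℂ →
      moeb k₀ (I • (1 : Matrix (Fin 2) (Fin 2) ℂ)) = I • 1 →
      ∃ P : MvPolynomial (((Fin 2 ⊕ Fin 2) × (Fin 2 ⊕ Fin 2)) ⊕ ((Fin 2 ⊕ Fin 2) × (Fin 2 ⊕ Fin 2))) ℂ,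
        ∀ (s : ℂ) (F : Matrix (Fin 2 ⊕ Fin 2) (Fin 2 ⊕ Fin 2) ℂ → ℂ), IsArchSiegelSection (fun z : ℂ => (conj z / ((‖z‖ : ℝ) : ℂ)) ^ k) s F →
          (∀ (v : Matrix (Fin 2) (Fin 2) ℂ), vᴴ * v = 1 → ∀ hv : v.det ≠ 0,
            F ((2 : ℂ)⁻¹ • fromBlocks (1 + v) (-(I • (1 - v))) (I • (1 - v)) (1 + v) : Matrix (Fin 2 ⊕ Fin 2) (Fin 2 ⊕ Fin 2) ℂ) = evalAt v hv Q) →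
          ∀ u : Matrix (Fin 2 ⊕ Fin 2) (Fin 2 ⊕ Fin 2) ℂ, uᴴ * Matrix.J (Fin 2) ℂ * u = Matrix.J (Fin 2) ℂ → moeb u (I • (1 : Matrix (Fin 2) (Fin 2) ℂ)) = I • 1 →
            F (u * k₀) = MvPolynomial.eval (Sum.elim (fun pq => u pq.1 pq.2) (fun pq => conj (u pq.1 pq.2))) P) :
    ∃ (Ew : ℂ → ℂ) (s₀ : ℝ), DifferentiableOn ℂ Ew {s : ℂ | 0 < s.re} ∧
      (∀ s : ℂ, s₀ < s.re →
        ∀ F : Matrix (Fin 2 ⊕ Fin 2) (Fin 2 ⊕ Fin 2) ℂ → ℂ, IsArchSiegelSection (fun z : ℂ => (conj z / ((‖z‖ : ℝ) : ℂ)) ^ k) s F →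
          (∀ (v : Matrix (Fin 2) (Fin 2) ℂ), vᴴ * v = 1 → ∀ hv : v.det ≠ 0,
            F ((2 : ℂ)⁻¹ • fromBlocks (1 + v) (-(I • (1 - v))) (I • (1 - v)) (1 + v) : Matrix (Fin 2 ⊕ Fin 2) (Fin 2 ⊕ Fin 2) ℂ) = evalAt v hv Q) →
          ∫ r : Fin 2 → Fin 2 → ℝ, F ((fromBlocks 0 B C 0 : Matrix (Fin 2 ⊕ Fin 2) (Fin 2 ⊕ Fin 2) ℂ) * fromBlocks 1 (hermOfReal r) 0 1 * g) * eb (hermOfReal r) =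
            Ew s) ∧
      ∀ z : ℂ, 0 < z.re → ∃ Cg cg N N' r : ℝ, 0 ≤ Cg ∧ 0 < cg ∧ 0 ≤ N ∧ 0 ≤ N' ∧ 0 < r ∧ ∀ s : ℂ, dist s z < r →
        ∀ (X₀ R : Matrix (Fin 2) (Fin 2) ℂ) (u₀ : Matrix (Fin 2 ⊕ Fin 2) (Fin 2 ⊕ Fin 2) ℂ), X₀ᴴ = X₀ → Rᴴ = R → IsUnit R.det →
          u₀ᴴ * Matrix.J (Fin 2) ℂ * u₀ = Matrix.J (Fin 2) ℂ → moeb u₀ (I • (1 : Matrix (Fin 2) (Fin 2) ℂ)) = I • 1 →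
          (fromBlocks C 0 0 (-B) : Matrix (Fin 2 ⊕ Fin 2) (Fin 2 ⊕ Fin 2) ℂ) * g = fromBlocks 1 X₀ 0 1 * fromBlocks R 0 0 R⁻¹ * u₀ →
          ‖Ew s‖ ≤ Cg * ‖R.det‖ ^ (2 - 2 * s.re) * Real.exp (-(cg * ∑ a, ∑ b, ‖(R * ((C⁻¹)ᴴ * hidx * C⁻¹) * R) a b‖)) *
            (1 + ∑ a, ∑ b, ‖(R * ((C⁻¹)ᴴ * hidx * C⁻¹) * R) a b‖) ^ N * (1 + ‖(R * ((C⁻¹)ᴴ * hidx * C⁻¹) * R).det‖ ^ (-N')) :=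
  exists_twistedWhittaker_growth_of_posDef_pic hk
    (fun (_ : ℂ) (F : Matrix (Fin 2 ⊕ Fin 2) (Fin 2 ⊕ Fin 2) ℂ → ℂ) => ∀ (v : Matrix (Fin 2) (Fin 2) ℂ), vᴴ * v = 1 → ∀ hv : v.det ≠ 0,
      F ((2 : ℂ)⁻¹ • fromBlocks (1 + v) (-(I • (1 - v))) (I • (1 - v)) (1 + v) : Matrix (Fin 2 ⊕ Fin 2) (Fin 2 ⊕ Fin 2) ℂ) = evalAt v hv Q)
    hx hg hpos heb hKpic

end Summit.HodgeConjecture.HodgeConjecture.Cruxes.HLiu418.K2LiuKindWArchWhittakerGrowth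

end
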